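import Summits.AtomisticToContinuum.BoseEinsteinCondensation.Theorems.BECLatticeDepthHomotopyModeIdentificationBounded
import Summits.AtomisticToContinuum.BoseEinsteinCondensation.Theorems.BECLatticeDepthHomotopyModeIdentificationDiagonalAverage
import Summits.AtomisticToContinuum.BoseEinsteinCondensation.Theorems.BECHusimiAmplitudeGasPositivityReductionShiftedModulus
import Literature.MathematicalPhysics.QuantumManyBody.PeriodicBoseGasImpurityTranslation
import HarnessLib

/-!
# Route `BECLatticeDepthHomotopy`, support item `ModeIdentification` (stmt-AtomisticToContinuum-12408):
# the mode identification from the Ky Fan gap, for EVERY pair potential (hard cores included)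

Helper file (supports, does not close, stmt-AtomisticToContinuum-12408). The item reads, at depth
`c = 0`, `Λ(0) ≤ periodicCondensateNumber v N L` (`N = 4m³`, all large `m`, small `ρ`), where
`Λ(0) = sup_{δ>0} inf {λ_max(γ_Ψ) : 𝓔^per[Ψ] ≤ E₀ + δ}` is the MODE-FREE and
`periodicCondensateNumber` the CONSTANT-MODE ground-state condensate number. It is proved in the tree
for bounded `v` (`modeIdentification_of_bounded`, Feynman–Kac/Perron–Frobenius) and reduced in
general to a rigid non-negative translation-invariant ground-state VECTOR
(`modeIdentification_of_rigid_unbounded`) — an object the tree cannot produce for hard cores (the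
hard-core ground state is Lipschitz, not `C¹`, and no Perron–Frobenius theorem for the killed
semigroup is available). This file removes the vector: the item follows, at each fixed `(N, L)` and
for EVERY measurable `v : ℝ → [0, ∞]`, from the purely variational nondegeneracy of the periodic
ground state in the tree's Ky Fan vocabulary,

  `2 · periodicGroundStateEnergy v N L < kyFanTwo v N L`

(`iSup_iInf_maxOccupation_le_periodicCondensateNumber_of_kyFanGap`). Proof: the gap gives
CLUSTERING of near-minimisers up to a phase (`exists_phase_integral_norm_sub_sq_le_of_kyFanGap`,
parallelogram law); a NON-NEGATIVE near-minimiser `Φ` exists at every slack (shifted modulus,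
`exists_nonneg_nearMinimiser_of_ne_top`); all common translates of `Φ` are again non-negative
near-minimisers (`periodicEnergy_translate`), so they cluster around `Φ` WITHOUT a phase, whence the
centre-of-mass average `A` of `Φ` (`exists_diagonalAverage`: continuous, non-negative, periodic,
translation-invariant, Jensen) is `L²`-close to `Φ` and every near-minimiser is close to a phase
times `A`; the reduction of the bounded case, re-run with the comparison state chosen AFTER the
tolerance (`iSup_iInf_maxOccupation_le_periodicCondensateNumber_of_rigid'`), concludes through the
Schur bound `λ_max(γ_A) ≤ n₀(A)` and the `L²`-Lipschitz bounds for `λ_max` and `n₀`.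

The route's readings (the `v`-clause and the decl `ModeIdentification` from the dilute periodic Ky
Fan gap; the clause for every INTEGRABLE `v` from the Faris–Simon fact
`PeriodicGroundStateNondegenerateIntegrable`) are in the companion file
`BECLatticeDepthHomotopyModeIdentificationKyFanGapRoute.lean`.

References: E. H. Lieb, R. Seiringer, J. P. Solovej, J. Yngvason (2005), §1.2 (1.17)–(1.19)
[LSSY2005]; O. Penrose, L. Onsager, Phys. Rev. 104 (1956) 576, §4 [PenroseOnsager1956]; M. Reed,
B. Simon, *Methods of Modern Mathematical Physics IV* (1978), Thm. XIII.1–2, §XIII.12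
[ReedSimonIV1978]; W. G. Faris, B. Simon, Duke Math. J. 42 (1975) 559 [FarisSimon1975].
-/

noncomputable section

namespace Summit.AtomisticToContinuum.BoseEinsteinCondensation.Theorems.ModeIdentification

open MeasureTheory Filter
open scoped ENNReal NNReal Topology ComplexConjugate
open Literature.MathematicalPhysics.QuantumManyBody.BoseGas
open Literature.Barriers.AtomisticToContinuum.BoseGas (periodicCondensateNumber le_periodicCondensateNumber)

variable {n N : ℕ} {L : ℝ}

/-- A strict Ky Fan gap `2E₀ < K₂` is a gap by a positive real: `2E₀ + γ ≤ K₂`, `γ > 0` (variant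
of `exists_ofReal_gap_of_two_mul_lt` of `BECHusimiAmplitudeGasPositivityReductionKyFan.lean` without
the finiteness hypothesis, kept here to avoid importing that route's thesis file). [folklore] -/
theorem exists_ofReal_gap_of_two_mul_lt' {E K : ℝ≥0∞} (h : 2 * E < K) :
    ∃ γ : ℝ, 0 < γ ∧ 2 * E + ENNReal.ofReal γ ≤ K := by
  by_cases hK : K = ⊤
  · exact ⟨1, one_pos, hK ▸ le_top⟩
  have hsub0 : K - 2 * E ≠ 0 := (tsub_pos_of_lt h).ne'
  have hsubtop : K - 2 * E ≠ ⊤ := ENNReal.sub_ne_top hK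
  refine ⟨(K - 2 * E).toReal, ENNReal.toReal_pos hsub0 hsubtop, ?_⟩
  rw [ENNReal.ofReal_toReal hsubtop, add_tsub_cancel_of_le h.le]

/-! ### The reduction, with the comparison state chosen after the tolerance -/

/-- **The reduction (fixed `N = n+1`, `L > 0`, any `v`), comparison state after the tolerance.**
Suppose that for every `η > 0` there are a continuous `F : (ℝ³)^{n+1} → ℂ`, pointwise a
non-negative real, `Lℤ³`-periodic in every particle, invariant under common translations, with
`∫_cell |F|² ≤ 1`, and a slack `δ > 0` such that every periodic `C¹` Bose state `Ψ` with
`𝓔^per_v[Ψ] ≤ E₀ + δ` satisfies `∫_cell |Ψ - αF|² ≤ η` for some `|α| ≤ 1`. Then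
`sup_{δ>0} inf_{𝓔[Ψ] ≤ E₀+δ} λ_max(γ_Ψ) ≤ periodicCondensateNumber v (n+1) L`. (Same proof as
`iSup_iInf_maxOccupation_le_periodicCondensateNumber_of_rigid`, where one `Ψ₀` served all `η`.)
[cite: LSSY2005, §1.2 (1.17)–(1.19)] -/
theorem iSup_iInf_maxOccupation_le_periodicCondensateNumber_of_rigid' (v : ℝ → ℝ≥0∞) (hL : 0 < L)
    (hrig : ∀ η : ℝ, 0 < η → ∃ F : Config (n + 1) → ℂ, Continuous F ∧ (∀ X, F X = (‖F X‖ : ℂ)) ∧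
      (∀ (X : Config (n + 1)) (i : Fin (n + 1)) (k : Fin 3),
        F (X + Pi.single i (EuclideanSpace.single k L)) = F X) ∧
      (∀ (u : Space) (X : Config (n + 1)), F (X + fun _ => u) = F X) ∧
      (∫⁻ X in cellN (n + 1) L, (‖F X‖₊ : ℝ≥0∞) ^ 2 ≤ 1) ∧
      ∃ δ : ℝ≥0∞, 0 < δ ∧ ∀ Ψ : PeriodicTrialState (n + 1) L,
        periodicEnergy v Ψ ≤ periodicGroundStateEnergy v (n + 1) L + δ →
          ∃ α : ℂ, ‖α‖ ≤ 1 ∧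
            ∫⁻ X in cellN (n + 1) L, (‖Ψ.ψ X - α * F X‖₊ : ℝ≥0∞) ^ 2 ≤ ENNReal.ofReal η) :
    (⨆ (δ : ℝ≥0∞) (_ : 0 < δ), ⨅ (Ψ : PeriodicTrialState (n + 1) L)
      (_ : periodicEnergy v Ψ ≤ periodicGroundStateEnergy v (n + 1) L + δ),
        maxOccupation (n + 1) ((cellN (n + 1) L).indicator Ψ.ψ)) ≤
      periodicCondensateNumber v (n + 1) L := by
  -- reduce to `∀ ε > 0`
  refine iSup₂_le fun δ hδ => ?_
  refine ENNReal.le_of_forall_pos_le_add fun ε hε hfin => ?_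
  -- error budget `ε = ε/3 + ε/3 + ε/3`
  have hε3 : (0 : ℝ) < (ε : ℝ) / 3 := div_pos (NNReal.coe_pos.2 hε) (by norm_num)
  have hε3' : ENNReal.ofReal ((ε : ℝ) / 3) = (ε : ℝ≥0∞) / 3 := by
    rw [ENNReal.ofReal_div_of_pos (by norm_num : (0 : ℝ) < 3), ENNReal.ofReal_coe_nnreal,
      ENNReal.ofReal_ofNat]
  have hε3pos : (0 : ℝ≥0∞) < (ε : ℝ≥0∞) / 3 := by rw [← hε3']; exact ENNReal.ofReal_pos.2 hε3
  obtain ⟨t, ht0, hterr⟩ := exists_errorBudget (n + 1) hε3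
  have herr : ENNReal.ofReal (((n + 1 : ℕ) : ℝ) * (2 * t + t ^ 2)) ≤ (ε : ℝ≥0∞) / 3 :=
    (ENNReal.ofReal_le_ofReal hterr).trans_eq hε3'
  -- the comparison state for the tolerance `η = t²`, and its slack
  obtain ⟨F, hFc, hreal, hperF, htransF, hF1, δt, hδt, hrigt⟩ := hrig (t ^ 2) (by positivity)
  -- Schur bound at the comparison state: `λ_max(F) ≤ n₀(F)`
  have hSchur := maxOccupation_indicator_le_condensateOccupation hL hFc hreal hperF htransF
  -- the working slack `δ' = min δ δ_t`
  set δ' : ℝ≥0∞ := min δ δt with hδ'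
  have hδ'0 : 0 < δ' := lt_min hδ hδt
  -- a `δ'`-near-minimiser almost realising the `n₀`-infimum
  have hb : (⨅ (Ψ : PeriodicTrialState (n + 1) L)
      (_ : periodicEnergy v Ψ ≤ periodicGroundStateEnergy v (n + 1) L + δ'),
        condensateOccupation (n + 1) L Ψ.ψ) ≤ periodicCondensateNumber v (n + 1) L :=
    le_periodicCondensateNumber v hδ'0 fun Ψ hΨ => iInf₂_le Ψ hΨ
  have hblt : (⨅ (Ψ : PeriodicTrialState (n + 1) L)
      (_ : periodicEnergy v Ψ ≤ periodicGroundStateEnergy v (n + 1) L + δ'),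
        condensateOccupation (n + 1) L Ψ.ψ) < periodicCondensateNumber v (n + 1) L + (ε : ℝ≥0∞) / 3 :=
    lt_of_le_of_lt hb (ENNReal.lt_add_right hfin.ne hε3pos.ne')
  obtain ⟨Ψ', hΨ'⟩ := iInf_lt_iff.1 hblt
  obtain ⟨hΨ'E, hΨ'n⟩ := iInf_lt_iff.1 hΨ'
  have hΨ'δ : periodicEnergy v Ψ' ≤ periodicGroundStateEnergy v (n + 1) L + δ :=
    hΨ'E.trans (add_le_add le_rfl (min_le_left _ _))
  have hΨ't : periodicEnergy v Ψ' ≤ periodicGroundStateEnergy v (n + 1) L + δt :=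
    hΨ'E.trans (add_le_add le_rfl (min_le_right _ _))
  -- rigidity: `Ψ'` is `t`-close to `αF`
  obtain ⟨α, hα1, hclose⟩ := hrigt Ψ' hΨ't
  have hgc : Continuous fun X => α * F X := continuous_const.mul hFc
  have hαe : (‖α‖₊ : ℝ≥0∞) ^ 2 ≤ 1 := by
    refine pow_le_one₀ zero_le ?_
    exact_mod_cast hα1
  have hg1 : ∫⁻ X in cellN (n + 1) L, (‖α * F X‖₊ : ℝ≥0∞) ^ 2 ≤ 1 := by
    have hX : ∀ X, (‖α * F X‖₊ : ℝ≥0∞) ^ 2 = (‖α‖₊ : ℝ≥0∞) ^ 2 * (‖F X‖₊ : ℝ≥0∞) ^ 2 :=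
      fun X => by rw [nnnorm_mul, ENNReal.coe_mul, mul_pow]
    simp_rw [hX]
    rw [lintegral_const_mul' _ _ (ENNReal.pow_ne_top ENNReal.coe_ne_top)]
    calc (‖α‖₊ : ℝ≥0∞) ^ 2 * ∫⁻ X in cellN (n + 1) L, (‖F X‖₊ : ℝ≥0∞) ^ 2
        ≤ 1 * 1 := mul_le_mul' hαe hF1
      _ = 1 := one_mul _
  have hclose' : ∫⁻ X in cellN (n + 1) L, (‖α * F X - Ψ'.ψ X‖₊ : ℝ≥0∞) ^ 2 ≤
      ENNReal.ofReal (t ^ 2) := by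
    have hX : ∀ X, ‖α * F X - Ψ'.ψ X‖₊ = ‖Ψ'.ψ X - α * F X‖₊ := fun X => by
      rw [← nnnorm_neg, neg_sub]
    simp_rw [hX]; exact hclose
  -- `λ_max(Ψ') ≤ λ_max(αF) + N(2t+t²)`
  have h1 := maxOccupation_indicator_le_of_sub_le L Ψ'.contDiff.continuous hgc hg1 ht0 hclose
  -- `λ_max(αF) = |α|² λ_max(F) ≤ |α|² n₀(F) = n₀(αF)`
  have h2 : maxOccupation (n + 1) ((cellN (n + 1) L).indicator fun X => α * F X) ≤
      condensateOccupation (n + 1) L fun X => α * F X := by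
    rw [maxOccupation_indicator_const_mul,
      Literature.MathematicalPhysics.QuantumManyBody.BoseGas.condensateOccupation_const_mul]
    exact mul_le_mul_right hSchur _
  -- `n₀(αF) ≤ n₀(Ψ') + N(2t+t²)`
  have h3 := condensateOccupation_le_of_sub_le hL hgc Ψ'.contDiff.continuous Ψ'.norm_eq.le ht0 hclose'
  -- chain
  calc (⨅ (Ψ : PeriodicTrialState (n + 1) L)
        (_ : periodicEnergy v Ψ ≤ periodicGroundStateEnergy v (n + 1) L + δ),
          maxOccupation (n + 1) ((cellN (n + 1) L).indicator Ψ.ψ))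
      ≤ maxOccupation (n + 1) ((cellN (n + 1) L).indicator Ψ'.ψ) := iInf₂_le Ψ' hΨ'δ
    _ ≤ maxOccupation (n + 1) ((cellN (n + 1) L).indicator fun X => α * F X) +
          ENNReal.ofReal (((n + 1 : ℕ) : ℝ) * (2 * t + t ^ 2)) := h1
    _ ≤ condensateOccupation (n + 1) L (fun X => α * F X) +
          ENNReal.ofReal (((n + 1 : ℕ) : ℝ) * (2 * t + t ^ 2)) := by gcongr
    _ ≤ condensateOccupation (n + 1) L Ψ'.ψ + ENNReal.ofReal (((n + 1 : ℕ) : ℝ) * (2 * t + t ^ 2)) +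
          ENNReal.ofReal (((n + 1 : ℕ) : ℝ) * (2 * t + t ^ 2)) := by gcongr
    _ ≤ (periodicCondensateNumber v (n + 1) L + (ε : ℝ≥0∞) / 3) + (ε : ℝ≥0∞) / 3 + (ε : ℝ≥0∞) / 3 :=
          add_le_add (add_le_add hΨ'n.le herr) herr
    _ = periodicCondensateNumber v (n + 1) L + ε := by
          rw [add_assoc, add_assoc, ← add_assoc ((ε : ℝ≥0∞) / 3), ENNReal.add_thirds]

/-! ### Bookkeeping: phases, non-negative reals, Bochner versus lower integrals -/

/-- For pointwise non-negative reals `a, b` (read in `ℂ`) and a phase `|c| = 1`, dropping the phase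
does not increase the distance: `|a - b| ≤ |a - c b|` (reverse triangle inequality). [folklore] -/
theorem nnnorm_sub_le_nnnorm_sub_mul_of_nonneg {a b c : ℂ} (ha : a = (‖a‖ : ℂ)) (hb : b = (‖b‖ : ℂ))
    (hc : ‖c‖ = 1) : ‖a - b‖₊ ≤ ‖a - c * b‖₊ := by
  rw [← NNReal.coe_le_coe, coe_nnnorm, coe_nnnorm]
  have h1 : ‖a - b‖ = |‖a‖ - ‖b‖| := by
    conv_lhs => rw [ha, hb, ← Complex.ofReal_sub, Complex.norm_real, Real.norm_eq_abs]
  have h2 : ‖c * b‖ = ‖b‖ := by rw [norm_mul, hc, one_mul]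
  rw [h1, ← h2]
  exact abs_norm_sub_norm_le a (c * b)

/-- A real bound on the Bochner cell integral of `|F|²` (continuous `F`) is a bound on the lower
integral: `∫_cell ‖F‖² ≤ η ⇒ ∫⁻_cell ‖F‖₊² ≤ ofReal η`. [folklore] -/
theorem lintegral_cellN_sq_le_ofReal_of_integral_le (L : ℝ) {F : Config N → ℂ} (hF : Continuous F)
    {η : ℝ} (h : ∫ X in cellN N L, ‖F X‖ ^ 2 ≤ η) :
    ∫⁻ X in cellN N L, (‖F X‖₊ : ℝ≥0∞) ^ 2 ≤ ENNReal.ofReal η := by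
  have hfin : (∫⁻ X in cellN N L, (‖F X‖₊ : ℝ≥0∞) ^ 2) ≠ ⊤ := (lintegral_cellN_sq_lt_top L hF).ne
  rw [← ENNReal.ofReal_toReal hfin, ← integral_cellN_norm_sq_eq_toReal L hF]
  exact ENNReal.ofReal_le_ofReal h

/-- `∫ |a + b|² ≤ 2 ∫ |a|² + 2 ∫ |b|²` on the cell, for continuous integrands. [folklore] -/
theorem lintegral_cellN_sq_add_le (L : ℝ) (f : Config N → ℂ) {g : Config N → ℂ} (hg : Continuous g) :
    ∫⁻ X in cellN N L, (‖f X + g X‖₊ : ℝ≥0∞) ^ 2 ≤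
      2 * (∫⁻ X in cellN N L, (‖f X‖₊ : ℝ≥0∞) ^ 2) + 2 * ∫⁻ X in cellN N L, (‖g X‖₊ : ℝ≥0∞) ^ 2 := by
  have h2 : ENNReal.ofReal (1 + 1) = 2 := by norm_num
  have h2' : ENNReal.ofReal (1 + 1⁻¹) = 2 := by norm_num
  have hgm : Measurable fun X => (‖g X‖₊ : ℝ≥0∞) ^ 2 :=
    hg.measurable.nnnorm.coe_nnreal_ennreal.pow_const 2
  calc ∫⁻ X in cellN N L, (‖f X + g X‖₊ : ℝ≥0∞) ^ 2
      ≤ ∫⁻ X in cellN N L, (2 * (‖f X‖₊ : ℝ≥0∞) ^ 2 + 2 * (‖g X‖₊ : ℝ≥0∞) ^ 2) := by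
        refine lintegral_mono fun X => ?_
        have h := coe_nnnorm_add_sq_le (f X) (g X) one_pos
        rwa [h2, h2'] at h
    _ = 2 * (∫⁻ X in cellN N L, (‖f X‖₊ : ℝ≥0∞) ^ 2) + 2 * ∫⁻ X in cellN N L, (‖g X‖₊ : ℝ≥0∞) ^ 2 := by
        rw [lintegral_add_right _ (hgm.const_mul 2), lintegral_const_mul' _ _ ENNReal.ofNat_ne_top,
          lintegral_const_mul' _ _ ENNReal.ofNat_ne_top]

/-! ### The mode identification from the Ky Fan gap, at fixed `(N, L)` -/

/-- **Mode identification from the Ky Fan gap (fixed `N = n+1`, `L > 0`, every measurable `v`, hard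
cores included).** If the periodic ground state is nondegenerate in Ky Fan form,
`2 · periodicGroundStateEnergy v (n+1) L < kyFanTwo v (n+1) L`, then the mode-free ground-state
condensate number is at most the constant-mode one:
`sup_{δ>0} inf_{𝓔[Ψ] ≤ E₀+δ} λ_max(γ_Ψ) ≤ periodicCondensateNumber v (n+1) L` (hence `=`, the other
direction being pointwise). No ground-state vector is used: the comparison state at tolerance `η` is
the centre-of-mass average of a non-negative near-minimiser (module docstring).
[cite: LSSY2005, §1.2 (1.17)–(1.19)] [cite: PenroseOnsager1956, §4] -/
theorem iSup_iInf_maxOccupation_le_periodicCondensateNumber_of_kyFanGap {v : ℝ → ℝ≥0∞}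
    (hv : Measurable v) (n : ℕ) (hL : 0 < L)
    (hgap : 2 * periodicGroundStateEnergy v (n + 1) L < kyFanTwo v (n + 1) L) :
    (⨆ (δ : ℝ≥0∞) (_ : 0 < δ), ⨅ (Ψ : PeriodicTrialState (n + 1) L)
      (_ : periodicEnergy v Ψ ≤ periodicGroundStateEnergy v (n + 1) L + δ),
        maxOccupation (n + 1) ((cellN (n + 1) L).indicator Ψ.ψ)) ≤
      periodicCondensateNumber v (n + 1) L := by
  -- finite ground-state energy and a positive real gap
  have hE : periodicGroundStateEnergy v (n + 1) L ≠ ⊤ := by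
    intro htop
    rw [htop, ENNReal.mul_top two_ne_zero] at hgap
    exact not_top_lt hgap
  obtain ⟨γ, hγ, hgap'⟩ := exists_ofReal_gap_of_two_mul_lt' hgap
  refine iSup_iInf_maxOccupation_le_periodicCondensateNumber_of_rigid' v hL fun η hη => ?_
  -- clustering of near-minimisers at tolerance `η/4`
  have hη4 : 0 < η / 4 := by positivity
  obtain ⟨δ, hδ, hclus⟩ := exists_phase_integral_norm_sub_sq_le_of_kyFanGap (N := n + 1) (L := L)
    hv hγ hE hgap' hη4
  -- a non-negative `δ`-near-minimiser `Φ`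
  obtain ⟨Φ, hΦreal, hΦE⟩ := exists_nonneg_nearMinimiser_of_ne_top (N := n + 1) v hL hE hδ
  have hΦc : Continuous Φ.ψ := Φ.contDiff.continuous
  -- its centre-of-mass average `A`
  obtain ⟨A, hAc, hAreal, hAper, hAtrans, hJensen⟩ := exists_diagonalAverage hL hΦc hΦreal Φ.periodic
  -- the common translates of `Φ` are non-negative `δ`-near-minimisers, hence close to `Φ` with NO phase
  have htr : ∀ u : Space, ∫⁻ X in cellN (n + 1) L,
      (‖Φ.ψ X - Φ.ψ (X + fun _ => u)‖₊ : ℝ≥0∞) ^ 2 ≤ ENNReal.ofReal (η / 4) := by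
    intro u
    obtain ⟨Φu, hΦu⟩ := Φ.exists_translate (-u)
    have hΦu' : ∀ X, Φu.ψ X = Φ.ψ (X + fun _ => u) := fun X => by
      rw [hΦu]
      show Φ.ψ (X - fun _ => -u) = Φ.ψ (X + fun _ => u)
      congr 1
      funext j
      simp [sub_neg_eq_add]
    have hEu : periodicEnergy v Φu = periodicEnergy v Φ := periodicEnergy_translate v Φ (-u) hΦu
    obtain ⟨θ, hθ⟩ := hclus Φ Φu hΦE (hEu ▸ hΦE)
    set c : ℂ := Complex.exp (↑θ * Complex.I) with hc
    have hc1 : ‖c‖ = 1 := Complex.norm_exp_ofReal_mul_I θ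
    have hcont : Continuous fun X => Φ.ψ X - c * Φu.ψ X :=
      hΦc.sub (continuous_const.mul Φu.contDiff.continuous)
    calc ∫⁻ X in cellN (n + 1) L, (‖Φ.ψ X - Φ.ψ (X + fun _ => u)‖₊ : ℝ≥0∞) ^ 2
        ≤ ∫⁻ X in cellN (n + 1) L, (‖Φ.ψ X - c * Φu.ψ X‖₊ : ℝ≥0∞) ^ 2 := by
          refine lintegral_mono fun X => ?_
          rw [← hΦu' X]
          gcongr
          exact nnnorm_sub_le_nnnorm_sub_mul_of_nonneg (hΦreal X) (hΦu' X ▸ hΦreal (X + fun _ => u)) hc1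
      _ ≤ ENNReal.ofReal (η / 4) := lintegral_cellN_sq_le_ofReal_of_integral_le L hcont hθ
  -- hence `Φ` is close to `A`, and `‖A‖ ≤ 1`
  have hΦA : ∫⁻ X in cellN (n + 1) L, (‖Φ.ψ X - A X‖₊ : ℝ≥0∞) ^ 2 ≤ ENNReal.ofReal (η / 4) :=
    hJensen Φ.ψ hΦc _ htr
  have hA1 : ∫⁻ X in cellN (n + 1) L, (‖A X‖₊ : ℝ≥0∞) ^ 2 ≤ 1 := by
    have h0 : ∀ u : Space, ∫⁻ X in cellN (n + 1) L,
        (‖(0 : ℂ) - Φ.ψ (X + fun _ => u)‖₊ : ℝ≥0∞) ^ 2 ≤ 1 := by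
      intro u
      have hshift := lintegral_cellN_comp_add hL (G := fun X => (‖Φ.ψ X‖₊ : ℝ≥0∞) ^ 2)
        (fun X i k => by simp only [Φ.periodic]) (fun _ => u)
      simp only [zero_sub, nnnorm_neg]
      rw [hshift, Φ.norm_eq]
    have h := hJensen (fun _ => 0) continuous_const 1 h0
    simpa only [zero_sub, nnnorm_neg] using h
  -- rigidity: every `δ`-near-minimiser is close to a phase times `A`
  refine ⟨A, hAc, hAreal, hAper, hAtrans, hA1, δ, hδ, fun Ψ hΨ => ?_⟩
  obtain ⟨θ, hθ⟩ := hclus Ψ Φ hΨ hΦE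
  set c : ℂ := Complex.exp (↑θ * Complex.I) with hc
  have hc1 : ‖c‖ = 1 := Complex.norm_exp_ofReal_mul_I θ
  have hcn : (‖c‖₊ : ℝ≥0∞) = 1 := by
    rw [← ENNReal.coe_one, ENNReal.coe_inj, ← NNReal.coe_inj, coe_nnnorm, hc1, NNReal.coe_one]
  refine ⟨c, hc1.le, ?_⟩
  have hΨc : Continuous Ψ.ψ := Ψ.contDiff.continuous
  have h1 : ∫⁻ X in cellN (n + 1) L, (‖Ψ.ψ X - c * Φ.ψ X‖₊ : ℝ≥0∞) ^ 2 ≤ ENNReal.ofReal (η / 4) :=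
    lintegral_cellN_sq_le_ofReal_of_integral_le L (hΨc.sub (continuous_const.mul hΦc)) hθ
  have h2 : ∫⁻ X in cellN (n + 1) L, (‖c * Φ.ψ X - c * A X‖₊ : ℝ≥0∞) ^ 2 ≤ ENNReal.ofReal (η / 4) := by
    have hX : ∀ X, (‖c * Φ.ψ X - c * A X‖₊ : ℝ≥0∞) = (‖Φ.ψ X - A X‖₊ : ℝ≥0∞) := fun X => by
      rw [← mul_sub, nnnorm_mul, ENNReal.coe_mul, hcn, one_mul]
    simp_rw [hX]
    exact hΦA
  have hsplit : ∀ X, Ψ.ψ X - c * A X = (Ψ.ψ X - c * Φ.ψ X) + (c * Φ.ψ X - c * A X) := fun X => by ring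
  simp_rw [hsplit]
  calc ∫⁻ X in cellN (n + 1) L, (‖(Ψ.ψ X - c * Φ.ψ X) + (c * Φ.ψ X - c * A X)‖₊ : ℝ≥0∞) ^ 2
      ≤ 2 * (∫⁻ X in cellN (n + 1) L, (‖Ψ.ψ X - c * Φ.ψ X‖₊ : ℝ≥0∞) ^ 2) +
          2 * ∫⁻ X in cellN (n + 1) L, (‖c * Φ.ψ X - c * A X‖₊ : ℝ≥0∞) ^ 2 :=
        lintegral_cellN_sq_add_le L _ ((continuous_const.mul hΦc).sub (continuous_const.mul hAc))
    _ ≤ 2 * ENNReal.ofReal (η / 4) + 2 * ENNReal.ofReal (η / 4) := by gcongr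
    _ = ENNReal.ofReal η := by
        rw [← two_mul, ← mul_assoc, ← ENNReal.ofReal_ofNat, ← ENNReal.ofReal_mul (by norm_num),
          ← ENNReal.ofReal_mul (by norm_num)]
        congr 1
        ring

/-- The same with the particle number written `N ≥ 1`. [cite: LSSY2005, §1.2 (1.17)–(1.19)] -/
theorem iSup_iInf_maxOccupation_le_periodicCondensateNumber_of_kyFanGap' {v : ℝ → ℝ≥0∞}
    (hv : Measurable v) (hN : 1 ≤ N) (hL : 0 < L)
    (hgap : 2 * periodicGroundStateEnergy v N L < kyFanTwo v N L) :
    (⨆ (δ : ℝ≥0∞) (_ : 0 < δ), ⨅ (Ψ : PeriodicTrialState N L)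
      (_ : periodicEnergy v Ψ ≤ periodicGroundStateEnergy v N L + δ),
        maxOccupation N ((cellN N L).indicator Ψ.ψ)) ≤
      periodicCondensateNumber v N L := by
  obtain ⟨n, rfl⟩ : ∃ n, N = n + 1 := ⟨N - 1, by omega⟩
  exact iSup_iInf_maxOccupation_le_periodicCondensateNumber_of_kyFanGap hv n hL hgap

end Summit.AtomisticToContinuum.BoseEinsteinCondensation.Theorems.ModeIdentification

end
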